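import Mathlib
import Literature.MathematicalPhysics.QuantumFieldTheory.Balaban1983to89.B1RT

/-!
# `Balaban1983to89.B2Eq337LastIntegrations` — T. Bałaban, *(Higgs)₂,₃ quantum fields in a finite volume. II. An upper bound*,
Commun. Math. Phys. **86** (1982) 555–594 [Balaban1982Higgs2], §3.B p. 591: **(3.36) → (3.37)** *"We apply the formula
(3.23) to the underintegral expression. Next we use (3.32) again and it follows that the integral (3.36) is equal to
∫dφ₀ exp(−½⟨φ₀, (−Δ^ε_{Ã^ε} + m²)φ₀⟩). (3.37)"* — the LAST INTEGRATIONS of §3.B PROVED as a Tonelli identity for a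
chain of levels with HISTORY-DEPENDENT normalized fluctuation kernels (the one-step kernels of (3.22) centred at
`Q(Ã^{(j)})φ_j` read the previous level, the composed kernels of (3.23) centred at `Q_k(Ã^ε)φ₀` read level 0), with
the Gaussian kernels (I.2.6)/(I.2.10) of `B1RT` as the model; and **(3.39)** *"Gathering together the equalities and the
estimates"* (3.35)–(3.38) ⇒ (3.39) as explicit bookkeeping with the printed `O(1)` identified; theorems + two plumbing defs

statement-level skeleton of published theorems with citation tags; proofs where landed; nothing here is a claim about the Yang–Mills mass gap

PDF held: `paper:balaban1982-cmp86-higgs23-ii` (journal page = PDF page + 554); pp. 588–591 READ AS IMAGES on the ×2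
renders `run/shared/lean/pub/pub-balaban/b2b-balaban-ref1/pages/1982-cmp86-higgs23-II/1982-cmp86-higgs23-II-p034-x2.png` …
`-p037-x2.png`.  Unit `lit-balaban-r14` gen 5 (reader/typer of B1–B2, SECOND READER of B2; B2 fold owner r02, §3
verifier r13), HOME `run/shared/lean/pub/lit-balaban/`.  SKELETON row **B2.Eq3.32** ((3.30)–(3.41); head `proved
p246000`; members (3.35), (3.37), (3.39)–(3.40) listed «absent (multi-scale integrals as displayed)» in the fold file
`lit-balaban-r02/ROWS-B2.md` v2.17): this file gives (3.37) (the identity «(3.36) = (3.37)» as a kernel theorem on a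
schematic chain of levels) and (3.39) (assembly).  Related tree results USED or PARALLEL: `B1RT.rtKernel` /
`integral_rtKernel_sub` (I (2.8) = (3.32), r14 g1), `B2Sect3BSmallFactors.eq336` ((3.36), r14 g3),
`B2Ineq338Diamagnetic.ineq338` ((3.38), p28 g4), `B1Ineq36LowerStep.KernelChain.integral_chainOp` (r14 g4: the MARKOV
special case — kernels reading the previous level only — of §1 below; this file removes that restriction, which (3.23)
needs: its composed kernels are centred at `Q_k(Ã^ε)φ₀`).

THE SOURCE TEXT (verbatim).  p. 590 [PDF 36]: *"Further, because there are no characteristic functions on the right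
side of (3.22) except the functions remaining in ζ_{Λ₀⁽ᵏ⁾}, so we can integrate with some exceptions, with respect to
the fields φ_K↾_{Λ₅⁽ᴷ⁻¹⁾ᶜ}, φ_{K−1}↾_{Λ₅⁽ᴷ⁻²⁾ᶜ}, …, φ₁↾_{Λ₅⁽⁰⁾ᶜ}, using the normalization properties of the renormalization
transformations ∫dφ_{k+l}(y) t^{Lᵏε}_{a_l,L^l,A}(φ_{k+l}(y), φ_k↾_{B^l(y)}) = 1. (3.32)"*  p. 591 [PDF 37]: *"The functions
ζ′_{Λ₀⁽ᵏ⁾} depend on the vector fields only. In the integral over Φ we make the transformation Φ = √2Φ′ and we get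
∫dΦ′Z(Ã^ε)exp(−½⟨Φ′, Δ(Ã^ε)Φ′⟩) exp ½log2 Σ_{k=0}^{K}|Λ_k|. (3.36)  We apply the formula (3.23) to the underintegral
expression. Next we use (3.32) again and it follows that the integral (3.36) is equal to ∫dφ₀ exp(−½⟨φ₀, (−Δ^ε_{Ã^ε} +
m²)φ₀⟩). (3.37)  We apply the "diamagnetic inequality" of paper [I.5] to this integral, and we estimate it by
∫dφ exp(−½⟨φ, (−Δ^ε + m²)φ⟩) = exp(E_{0,s}). (3.38)  Gathering together the equalities and the estimates, we get
(the expression {…} on the left side of (3.22)) ≦ Π_{k=0}^{K−1} ζ′_{Λ₀⁽ᵏ⁾} exp(E_{0,s}) exp(O(1) Σ_{k=0}^{K}|Λ_k|). (3.39)"*;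
(3.35) p. 591: *"(the right side of (3.22)) ≦ ∫dΦ Z(Ã^ε) · exp(−¼⟨Φ, Δ(Ã^ε)Φ⟩) Π_{k=0}^{K−1} ζ′_{Λ₀⁽ᵏ⁾} · exp Σ_{k=1}^{K}
O((Lᵏε)^{κ₀})|Λ_k|."*; (3.22)/(3.23) p. 588: the curly bracket is `∫dφ_K T^{L^{K−1}ε}_{a,L,Ã^{(K−1)},ε}(Λ₅⁽ᴷ⁻¹⁾ᶜ) ⋯
T^ε_{a,L,Ã^ε}(Λ₅⁽⁰⁾ᶜ)[… (Π_{k=1}^{K} T^ε_{a_k,Lᵏ,Ã^ε}(Bᵏ(Λ₅⁽ᵏ⁻¹⁾′∩Λ₅⁽ᵏ⁾ᶜ))) · [exp(−½⟨φ₀, (−Δ^ε_{Ã^ε} + m²)φ₀⟩)]]]`, whose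
part standing right of the characteristic functions is (3.23) = `∫dφ₀↾_{Λ₅⁽⁰⁾} exp[−½Σ_{k=1}^{K} a_k(Lᵏε)^{d−2}
Σ_{x_k∈Λ₅⁽ᵏ⁻¹⁾′∩Λ₅⁽ᵏ⁾ᶜ}|φ_k(x_k) − (Q_k(Ã^ε)φ₀)(x_k)|² − ½⟨φ₀, (−Δ^ε_{Ã^ε} + m²)φ₀⟩]` *"omitting the constants in the
definition of renormalization transformations"* / *"where all the constants coming from the renormalization
transformations are included in Z(Ã^ε)"* (p. 590).

THE MODEL (schematic; the regions Λ₅⁽ʲ⁾, the primes and (3.24) are NOT constructed).  Levels `j = 0, 1, …, K` with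
configuration spaces `X j` (↤ `X 0` = the fine scalar field φ₀ on the whole torus — both its part `φ₀↾_{Λ₅⁽⁰⁾ᶜ}` kept in
Φ′ and its part `φ₀↾_{Λ₅⁽⁰⁾}` integrated in (3.23); `X (j+1)` = the block field φ_{j+1} on the sites of scale j+1 that
carry it: `(Λ₅⁽ʲ⁾ᶜ)⁽¹⁾` (images of the outer one-step transformation `T(Λ₅⁽ʲ⁾ᶜ)`) and the annulus `Λ_{j+1}` (images of the
composed transformation `T_{a_{j+1},L^{j+1}}(B^{j+1}(Λ_{j+1}))`)), each with its Lebesgue measure; a weight `g : X 0 →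
[0,∞]` (↤ `exp(−½⟨φ₀, (−Δ^ε_{Ã^ε} + m²)φ₀⟩)`, constants stripped); and for each `j` a LEVEL-(j+1) KERNEL `k j : (Π i, X i) →
[0,∞]` which (a) reads only the levels `≤ j+1` and (b) is a probability density in the level-(j+1) variable for every
history — in the paper the product over the sites `y` of scale j+1 of the Gaussian kernels (I.2.6) `t(φ_{j+1}(y),
φ_j↾_{B(y)})` (centre `(Q(Ã^{(j)})φ_j)(y)`, reads level j) and (I.2.10) `t_{a_{j+1},L^{j+1}}(φ_{j+1}(y), φ₀↾_{B^{j+1}(y)})`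
(centre `(Q_{j+1}(Ã^ε)φ₀)(y)`, reads level 0), each normalized by (3.32) = I (2.8) — §2 builds exactly these
(`gaussLevel`) from `B1RT.rtKernel` with arbitrary measurable centre maps reading the levels `≤ j`.  The curly bracket
of (3.22) with the characteristic functions already estimated away ((3.30)–(3.34)), the ζ′ and the constants pulled
out, i.e. the integral (3.36) without its factor `exp ½log2 Σ|Λ_k|`, is then the iterated integral over all levels of
`g(x 0) · Π_{j<K} k j x` (`chainDensity`), and (3.37) says it equals `∫ g dφ₀`.

WHAT IS PROVED (kernel, no `sorry`, axioms standard).  §1 (general, Mathlib `lmarginal` over the levels `range (K+1)`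
of an `ℕ`-indexed family of σ-finite measure spaces) `lintegral_chainDensity_update` (*"we use (3.32) again"*: the top
level integrates to 1 and disappears), **`lmarginal_chainDensity`** (`(∫⋯∫⁻_{range (K+1)}, g(x₀)·Π_{j<K} k_j ∂μ) = ∫⁻ g dμ₀`
for history-dependent normalized kernels — induction on K, Tonelli through `lmarginal_insert'`).  §2 (the Gaussian
model) `gaussLevel` (+ private measurability / level-dependence lemmas), **`lintegral_gaussLevel_update`**
(= (3.32) for a whole level: `∫dφ_{j+1} Π_y t_y(φ_{j+1}(y) − c_y) = 1`, from `B1RT.integral_rtKernel_sub` site by site,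
Fubini `integral_fintype_prod_volume_eq_prod`), **`lmarginal_gaussLevels_eq`** (= «(3.36) = (3.37)»: the all-level
integral of `g(φ₀)·Π_j Π_y t_{β_{j,y}}(φ_{j+1}(y) − c_{j,y}(φ₀,…,φ_j))` equals `∫dφ₀ g(φ₀)` for ALL positive precisions
β_{j,y} (↤ `a(L^{j+1}ε)^{d−2}` resp. `a_{j+1}(L^{j+1}ε)^{d−2}`), all measurable centre maps reading the levels ≤ j, every
measurable `g ≥ 0`, every finite site types).  §3 **`ineq339_of_335_338`** ((3.35) ∧ (3.36) ∧ (3.37) ∧ (3.38) ⇒ (3.39) with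
the printed `O(1)` = the Jacobian constant of (3.36) (`½log2` per real field component) + the uniform bound of the
`O((Lᵏε)^{κ₀})`, `Lᵏε ≦ 1`; the (3.35) sum over k = 1…K is dominated by the (3.39) sum over k = 0…K).
HONEST SCOPE.  (i) SCHEMATIC: the theorem is about the integration structure the text describes (normalized kernels,
level by level, each reading only lower levels), not about the concrete sets of (3.21)–(3.24); that the paper's kernels
have this structure is the dictionary above (each φ_{j+1}(y) carries exactly one kernel; the *"exceptions"* `y ∈ P_s⁽ᵏ⁾`
were removed at (3.33)–(3.34)).  (ii) `[0,∞]`-valued (Tonelli) form; the constants `Z(Ã^ε)`, `exp ½log2 Σ|Λ_k|` and the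
ζ′ (which *"depend on the vector fields only"*) are outside the scalar-field integral and enter only §3.  (iii) (3.38),
(3.35), (3.36) are hypotheses of §3 by design (proved resp. in `B2Ineq338Diamagnetic`, —, `B2Sect3BSmallFactors.eq336`);
(3.40) (the vector-field analogue after (3.21)) is not treated.  Value = kernel certificate of the published
integration step in schematic coordinates; NOT summit progress.
-/

noncomputable section

namespace Literature.MathematicalPhysics.QuantumFieldTheory.Balaban1983to89.B2Eq337LastIntegrations

open MeasureTheory Finset Function
open scoped ENNReal

/-! ## §1  History-dependent normalized kernels: the top level integrates away -/

section General

variable {X : ℕ → Type*} [∀ i, MeasurableSpace (X i)]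

/-- **THE INTEGRAND AFTER `K` LEVELS**: `g(x₀) · Π_{j<K} k_j(x)` — the weight at level 0 times the level kernels
(dictionary in the module docstring: ↤ the underintegral expression of (3.36) with the constants, the ζ′ and the factor
`exp ½log2 Σ|Λ_k|` removed). [cite: Balaban1982Higgs2, (3.22)–(3.23) p.588, (3.36) p.591, dictionary] -/
def chainDensity (g : X 0 → ℝ≥0∞) (k : ℕ → (∀ i, X i) → ℝ≥0∞) (K : ℕ) (x : ∀ i, X i) : ℝ≥0∞ :=
  g (x 0) * ∏ j ∈ range K, k j x

/-- measurability of the integrand. [folklore] -/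
private theorem measurable_chainDensity {g : X 0 → ℝ≥0∞} (hg : Measurable g)
    {k : ℕ → (∀ i, X i) → ℝ≥0∞} (hk : ∀ j, Measurable (k j)) (K : ℕ) :
    Measurable (chainDensity g k K) :=
  (hg.comp (measurable_pi_apply 0)).mul (Finset.measurable_prod _ fun j _ => hk j)

variable (μ : ∀ i, Measure (X i))

/-- *"Next we use (3.32) again"* — ONE LEVEL: if the kernel `k_K` is a probability density in the level-(K+1) variable
for every history and the kernels `k_j`, `j < K`, do not read the level K+1, then integrating the level K+1 out of
`g(x₀)Π_{j<K+1}k_j` leaves `g(x₀)Π_{j<K}k_j`. [cite: Balaban1982Higgs2, (3.32) p.590 / (3.37) p.591 (mechanism)] -/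
theorem lintegral_chainDensity_update (g : X 0 → ℝ≥0∞) {k : ℕ → (∀ i, X i) → ℝ≥0∞} (hk : ∀ j, Measurable (k j))
    (hdep : ∀ j i, j + 1 < i → ∀ (x : ∀ i, X i) (y : X i), k j (update x i y) = k j x)
    (hnorm : ∀ j (x : ∀ i, X i), ∫⁻ y, k j (update x (j + 1) y) ∂μ (j + 1) = 1) (K : ℕ) (x : ∀ i, X i) :
    ∫⁻ y, chainDensity g k (K + 1) (update x (K + 1) y) ∂μ (K + 1) = chainDensity g k K x := by
  have h1 : ∀ y, chainDensity g k (K + 1) (update x (K + 1) y)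
      = chainDensity g k K x * k K (update x (K + 1) y) := by
    intro y
    simp only [chainDensity]
    rw [Function.update_of_ne (by omega : (0 : ℕ) ≠ K + 1), Finset.prod_range_succ]
    have hp : ∏ j ∈ range K, k j (update x (K + 1) y) = ∏ j ∈ range K, k j x :=
      Finset.prod_congr rfl fun j hj => hdep j (K + 1) (by rw [Finset.mem_range] at hj; omega) x y
    rw [hp, mul_assoc]
  simp_rw [h1]
  have hm : Measurable (fun y : X (K + 1) => k K (update x (K + 1) y)) := (hk K).comp (measurable_update x)
  rw [lintegral_const_mul _ hm, hnorm K x, mul_one]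

variable [∀ i, SigmaFinite (μ i)]

/-- **THE LAST INTEGRATIONS** (mechanism of «(3.36) = (3.37)»): for an `ℕ`-indexed chain of σ-finite levels, a
measurable weight `g` at level 0 and measurable level kernels `k_j` that read only the levels `≤ j+1` and are
probability densities in the level-(j+1) variable for EVERY history (history-dependent, not only Markov), integrating
out the levels `0, …, K` of `g(x₀)·Π_{j<K}k_j(x)` gives `∫ g dμ₀` — induction on `K`, the top level first (Tonelli,
Mathlib `lmarginal_insert'`). [cite: Balaban1982Higgs2, (3.37) p.591 «we use (3.32) again and it follows that the integral (3.36) is equal to (3.37)» (mechanism)] -/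
theorem lmarginal_chainDensity {g : X 0 → ℝ≥0∞} (hg : Measurable g) {k : ℕ → (∀ i, X i) → ℝ≥0∞}
    (hk : ∀ j, Measurable (k j))
    (hdep : ∀ j i, j + 1 < i → ∀ (x : ∀ i, X i) (y : X i), k j (update x i y) = k j x)
    (hnorm : ∀ j (x : ∀ i, X i), ∫⁻ y, k j (update x (j + 1) y) ∂μ (j + 1) = 1) (K : ℕ) (x : ∀ i, X i) :
    (∫⋯∫⁻_range (K + 1), chainDensity g k K ∂μ) x = ∫⁻ y, g y ∂μ 0 := by
  induction K generalizing x with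
  | zero =>
    rw [zero_add, Finset.range_one, lmarginal_singleton]
    simp [chainDensity]
  | succ K ih =>
    rw [Finset.range_add_one, lmarginal_insert' _ (measurable_chainDensity hg hk (K + 1)) notMem_range_self]
    have hfun : (fun x : ∀ i, X i => ∫⁻ y, chainDensity g k (K + 1) (update x (K + 1) y) ∂μ (K + 1))
        = chainDensity g k K :=
      funext fun x => lintegral_chainDensity_update μ g hk hdep hnorm K x
    rw [hfun]
    exact ih x

end General

/-! ## §2  The Gaussian model: levels of block fields with the kernels (I.2.6)/(I.2.10) -/

section Gaussian

variable {V : Type*} [NormedAddCommGroup V] [InnerProductSpace ℝ V] [FiniteDimensional ℝ V]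
  [MeasurableSpace V] [BorelSpace V]
variable {S : ℕ → Type*} [∀ j, Fintype (S j)]

/-- **THE LEVEL-(j+1) GAUSSIAN KERNEL**: `Π_{y ∈ S_{j+1}} t_{β_{j,y}}(φ_{j+1}(y) − c_{j,y}(φ₀, …, φ_j))` with `B1RT.rtKernel β
v = (β/2π)^{N/2}exp(−½β|v|²)` — the product over the sites of scale j+1 of the single-site kernels (I.2.6) (precision
`a(L^{j+1}ε)^{d−2}`, centre `(Q(Ã^{(j)})φ_j)(y)`) resp. (I.2.10) (precision `a_{j+1}(L^{j+1}ε)^{d−2}`, centre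
`(Q_{j+1}(Ã^ε)φ₀)(y)`), with arbitrary site-dependent precisions `β j y` and centre maps `c j`, as an `[0,∞]`-valued
density on the configuration `x = (φ₀, φ₁, …)`, `φ_i : S i → V`.
[cite: Balaban1982Higgs2, (3.22)–(3.23) p.588 / I (2.6), (2.10), dictionary] -/
def gaussLevel (β : (j : ℕ) → S (j + 1) → ℝ) (c : (j : ℕ) → ((i : ℕ) → S i → V) → S (j + 1) → V) (j : ℕ)
    (x : (i : ℕ) → S i → V) : ℝ≥0∞ :=
  ENNReal.ofReal (∏ y : S (j + 1), B1RT.rtKernel (β j y) (x (j + 1) y - c j x y))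

variable {β : (j : ℕ) → S (j + 1) → ℝ} {c : (j : ℕ) → ((i : ℕ) → S i → V) → S (j + 1) → V}

/-- measurability of the level kernels (for measurable centre maps). [folklore] -/
private theorem measurable_gaussLevel (hc : ∀ j, Measurable (c j)) (j : ℕ) : Measurable (gaussLevel β c j) := by
  unfold gaussLevel
  refine ENNReal.measurable_ofReal.comp (Finset.measurable_prod _ fun y _ => ?_)
  exact (B1RT.continuous_rtKernel (β j y)).measurable.comp
    (((measurable_pi_apply y).comp (measurable_pi_apply (j + 1))).sub ((measurable_pi_apply y).comp (hc j)))

omit [FiniteDimensional ℝ V] [MeasurableSpace V] [BorelSpace V] in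
/-- the level-(j+1) kernel does not read the levels above j+1 (if its centre map reads only the levels ≤ j).
[folklore] -/
private theorem gaussLevel_update_of_lt
    (hcdep : ∀ j i, j + 1 ≤ i → ∀ (x : (i : ℕ) → S i → V) (y : S i → V), c j (update x i y) = c j x)
    (j i : ℕ) (hji : j + 1 < i) (x : (i : ℕ) → S i → V) (y : S i → V) :
    gaussLevel β c j (update x i y) = gaussLevel β c j x := by
  unfold gaussLevel
  rw [Function.update_of_ne (by omega : j + 1 ≠ i), hcdep j i hji.le x y]

/-- **(3.32) FOR A WHOLE LEVEL** (= I (2.8) site by site + Fubini): for positive precisions the level-(j+1) kernel is a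
probability density in `φ_{j+1}` for EVERY history: `∫dφ_{j+1} Π_y t_{β_{j,y}}(φ_{j+1}(y) − c_{j,y}) = 1`
(`B1RT.integral_rtKernel_sub` = *"∫dφ_{k+l}(y) t(φ_{k+l}(y), φ_k↾_{B^l(y)}) = 1"*, `integral_fintype_prod_volume_eq_prod`).
[cite: Balaban1982Higgs2, (3.32) p.590] -/
theorem lintegral_gaussLevel_update (hβ : ∀ j y, 0 < β j y)
    (hcdep : ∀ j i, j + 1 ≤ i → ∀ (x : (i : ℕ) → S i → V) (y : S i → V), c j (update x i y) = c j x)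
    (j : ℕ) (x : (i : ℕ) → S i → V) :
    ∫⁻ ψ, gaussLevel β c j (update x (j + 1) ψ) = 1 := by
  unfold gaussLevel
  simp_rw [Function.update_self, hcdep j (j + 1) le_rfl x]
  have hint : Integrable (fun ψ : S (j + 1) → V => ∏ y, B1RT.rtKernel (β j y) (ψ y - c j x y)) :=
    Integrable.fintype_prod (f := fun y (v : V) => B1RT.rtKernel (β j y) (v - c j x y))
      (fun y => B1RT.integrable_rtKernel_sub (hβ j y) _)
  have hnn : 0 ≤ᵐ[volume] fun ψ : S (j + 1) → V => ∏ y, B1RT.rtKernel (β j y) (ψ y - c j x y) :=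
    ae_of_all _ fun ψ => Finset.prod_nonneg fun y _ => B1RT.rtKernel_nonneg (hβ j y).le _
  rw [← ofReal_integral_eq_lintegral_ofReal hint hnn]
  have h := integral_fintype_prod_volume_eq_prod (𝕜 := ℝ) (fun y (v : V) => B1RT.rtKernel (β j y) (v - c j x y))
  simp only [B1RT.integral_rtKernel_sub (hβ j _), Finset.prod_const_one] at h
  rw [h, ENNReal.ofReal_one]

/-- **«(3.36) = (3.37)»**: for every `K`, all positive precisions `β_{j,y}`, all measurable centre maps `c_j` reading only
the levels `≤ j` (↤ `Q(Ã^{(j)})φ_j`, `Q_{j+1}(Ã^ε)φ₀`) and every measurable weight `g ≥ 0` at level 0 (↤ `exp(−½⟨φ₀,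
(−Δ^ε_{Ã^ε} + m²)φ₀⟩)`), the integral over all the levels `φ₀, φ₁, …, φ_K` of `g(φ₀)·Π_{j<K}Π_y t_{β_{j,y}}(φ_{j+1}(y) −
c_{j,y}(φ₀,…,φ_j))` equals `∫dφ₀ g(φ₀)` — (3.37) *"we use (3.32) again and it follows that the integral (3.36) is equal to
∫dφ₀ exp(−½⟨φ₀, (−Δ^ε_{Ã^ε} + m²)φ₀⟩)"* (the factor `exp ½log2 Σ|Λ_k|` of (3.36) and `Z(Ã^ε)` standing outside).
[cite: Balaban1982Higgs2, (3.36)–(3.37) p.591 (schematic levels; constant-free)] -/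
theorem lmarginal_gaussLevels_eq (hβ : ∀ j y, 0 < β j y) (hc : ∀ j, Measurable (c j))
    (hcdep : ∀ j i, j + 1 ≤ i → ∀ (x : (i : ℕ) → S i → V) (y : S i → V), c j (update x i y) = c j x)
    {g : (S 0 → V) → ℝ≥0∞} (hg : Measurable g) (K : ℕ) (x : (i : ℕ) → S i → V) :
    (∫⋯∫⁻_range (K + 1), chainDensity (X := fun i => S i → V) g (gaussLevel β c) K
        ∂fun i => (volume : Measure (S i → V))) x = ∫⁻ φ₀, g φ₀ :=
  lmarginal_chainDensity (X := fun i => S i → V) (fun i => (volume : Measure (S i → V))) hg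
    (measurable_gaussLevel hc) (gaussLevel_update_of_lt hcdep) (lintegral_gaussLevel_update hβ hcdep) K x

end Gaussian

/-! ## §3  (3.39): gathering (3.35)–(3.38) -/

/-- **(3.39)** p. 591 *"Gathering together the equalities and the estimates, we get (the expression {…} on the left side
of (3.22)) ≦ Π_{k=0}^{K−1} ζ′_{Λ₀⁽ᵏ⁾} exp(E_{0,s}) exp(O(1) Σ_{k=0}^{K}|Λ_k|)"* AS BOOKKEEPING, with the printed `O(1)` made
explicit: from (3.35) `{…} ≦ I₄·Z′·exp(Σ_{k=1}^{K} c_k|Λ_k|)` (`I₄` = `∫dΦ Z(Ã^ε)exp(−¼⟨Φ,Δ(Ã^ε)Φ⟩)`, `Z′ = Πζ′ ≧ 0`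
pulled out since the ζ′ *"depend on the vector fields only"*, `|c_k| ≦ C` the uniform bound of the `O((Lᵏε)^{κ₀})`,
`Lᵏε ≦ 1`), (3.36) `I₄ = exp(c₂Σ_{k=0}^{K}|Λ_k|)·I₂` (`c₂` the Jacobian constant of Φ = √2Φ′, `½log2` per real
component; `B2Sect3BSmallFactors.eq336`), (3.37) `I₂ = J` (`lmarginal_gaussLevels_eq`) and (3.38) `J ≦ exp(E_{0,s})`
(`B2Ineq338Diamagnetic.ineq338`):  `{…} ≦ Z′·exp(E_{0,s})·exp((c₂ + C)Σ_{k=0}^{K}|Λ_k|)`, i.e. (3.39) with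
`O(1) = c₂ + C`. [cite: Balaban1982Higgs2, (3.35)–(3.39) p.591 (bookkeeping; explicit O(1))] -/
theorem ineq339_of_335_338 {lhs I₄ I₂ J E0s Zp C c₂ : ℝ} {K : ℕ} {vol c : ℕ → ℝ}
    (hZp : 0 ≤ Zp) (hvol : ∀ k, 0 ≤ vol k) (hc : ∀ k, |c k| ≤ C)
    (h335 : lhs ≤ I₄ * Zp * Real.exp (∑ k ∈ Icc 1 K, c k * vol k))
    (h336 : I₄ = Real.exp (c₂ * ∑ k ∈ range (K + 1), vol k) * I₂)
    (h337 : I₂ = J) (h338 : J ≤ Real.exp E0s) :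
    lhs ≤ Zp * Real.exp E0s * Real.exp ((c₂ + C) * ∑ k ∈ range (K + 1), vol k) := by
  have hC : 0 ≤ C := (abs_nonneg _).trans (hc 0)
  set T : ℝ := ∑ k ∈ range (K + 1), vol k with hT
  have hT0 : 0 ≤ T := Finset.sum_nonneg fun k _ => hvol k
  -- the (3.35) exponent is dominated by `C·T`
  have hsub : Icc 1 K ⊆ range (K + 1) := fun k hk => by
    rw [Finset.mem_Icc] at hk; rw [Finset.mem_range]; omega
  have hexp : ∑ k ∈ Icc 1 K, c k * vol k ≤ C * T := by
    calc ∑ k ∈ Icc 1 K, c k * vol k ≤ ∑ k ∈ Icc 1 K, C * vol k :=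
          Finset.sum_le_sum fun k _ => mul_le_mul_of_nonneg_right ((le_abs_self _).trans (hc k)) (hvol k)
      _ ≤ ∑ k ∈ range (K + 1), C * vol k :=
          Finset.sum_le_sum_of_subset_of_nonneg hsub fun k _ _ => mul_nonneg hC (hvol k)
      _ = C * T := by rw [hT, Finset.mul_sum]
  have hE : Real.exp (∑ k ∈ Icc 1 K, c k * vol k) ≤ Real.exp (C * T) := Real.exp_le_exp.mpr hexp
  -- (3.36)–(3.38): I₄ ≤ exp(c₂T)·exp(E0s)
  have hI4 : I₄ ≤ Real.exp (c₂ * T) * Real.exp E0s := by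
    rw [h336, h337]
    exact mul_le_mul_of_nonneg_left h338 (Real.exp_pos _).le
  have h1 : I₄ * Zp * Real.exp (∑ k ∈ Icc 1 K, c k * vol k)
      ≤ (Real.exp (c₂ * T) * Real.exp E0s) * Zp * Real.exp (∑ k ∈ Icc 1 K, c k * vol k) :=
    mul_le_mul_of_nonneg_right (mul_le_mul_of_nonneg_right hI4 hZp) (Real.exp_pos _).le
  have h2 : (Real.exp (c₂ * T) * Real.exp E0s) * Zp * Real.exp (∑ k ∈ Icc 1 K, c k * vol k)
      ≤ (Real.exp (c₂ * T) * Real.exp E0s) * Zp * Real.exp (C * T) :=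
    mul_le_mul_of_nonneg_left hE (by positivity)
  have h3 : (Real.exp (c₂ * T) * Real.exp E0s) * Zp * Real.exp (C * T)
      = Zp * Real.exp E0s * Real.exp ((c₂ + C) * T) := by
    rw [add_mul, Real.exp_add]; ring
  linarith [h1, h2, h3.le]

end Literature.MathematicalPhysics.QuantumFieldTheory.Balaban1983to89.B2Eq337LastIntegrations

end
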